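/-
Origin: expansion seat `prover-pub-hodgecm-mc-binder-1-g8-0`, handover #16 17:20Z md5 4b84a052adab (448 l.; r2 of 184a3ee240ef = + `compactSpace_principalQuot` / `compactSpace_subQuot` (the two compactness instances as `haveI` terms for consumers); NEW additive KERNEL leaf, ns HodgeCM.QuotientModel + HodgeCM.Model; ROW 15 `real34` — the AUTOMORPHIC PART of the junction-composite (L-loc) of kit #14 `Real34Meet` (model1 16:27:22Z: (D1-meet) ⊕ (J-cov′) ⊕ (E3) ⊕ (J-τ34)), i.e. (D1-meet) APPLIED + (J-τ34)(a)(b), in `Level`-free currency: § 1 data defs `QuotientModel.rTranslate/rTranslate₂` (right translates `g ↦ φ(g a)` of global left-invariant functions), `wedge₂_rTranslate₂`, **`R_realise`** (`R(a) (realise φ) = realise (φ(· a))`) + `R_realise_wedge₂` = (J-τ34)(a); § 2 `regimeEquivT` (= `Adelic.regimeEquiv` typed on the tree currency, reducible alias) + `_mem_Γ_iff`, **`conjLevel_cmSplitLevel_inf_eq`** (`k⁻¹ M_{K₁∩K'} k = M_{K₁ ∩ k_f⁻¹K'k_f}` for `k_f ∈ K₁`), `normal_awayFromCM`, currency lemmas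 `sat_comp_regimeEquiv_of_sat` / `sat_of_sat_comp_regimeEquiv` (mc-discharge-1's `SatLevel` shape ⇔ right-invariance of `G ∘ e` under `satLevelOf V K` on `U(V)(𝔸)`), `rTranslate₂_apply_regimeEquiv`, **`sat_rTranslate₂`** = (J-τ34)(b) (translate of a `K'`-saturated representative is saturated at every `K'' ≤ a_f K' a_f⁻¹`); § 3 **`exists_inner_pieceEmb_rTranslate₂_ne_zero`** (maxHeartbeats 800000; elaboration of the long statement + instance families): `K₁` compact open, `K'` open, `f ∈ C(Λ_{K₁}\U(V)(L⊗ℝ))`, `G₃ G₄ ∈ leftInvCont₂` saturated at `K'` (on `U(V)(𝔸)`), `⟪pieceEmb_{M_{K₁}} f, realise (G₃ ∧ G₄)⟫ ≠ 0 ⇒ ∃ k_f ∈ K₁: ⟪pieceEmb_{M_{K₁ ∩ k_f⁻¹K'k_f}, π₁∘incl, [1]} (f ∘ levelCover), realise (G₃(· e(1,k_f⁻¹)) ∧ G₄(· e(1,k_f⁻¹)))⟫ ≠ 0 and both translates saturated at `K₁ ∩ k_f⁻¹K'k_f` (compactness instances stated tree-style as binders, discharged by the consumer from Godement / `compactSpace_quotient_pieceLattice`).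 Proof = #V1 meeting lemma for `M = M_{K₁}`, `M' = M_{K₁∩K'}`, reps from #V2, compactness via Godement (`hanis_of_isAnisotropic hV`) + #V3, re-levelling `pieceLiftLp_levelCover_congr`, unitary transport `QuotientModel.transportL2` (`inner_pieceEmb_left_eq_inner_pieceLiftLp`, `transportL2_translateLp`) + § 1. REMAINS of (L-loc) for RUN 37 (`Model/Binders/Real34Localisation`, this lineage, (W1) world): (E3) the met level as the pair `(Γ(K₁ ∩ k_f⁻¹K'k_f), K₁ ∩ k_f⁻¹K'k_f)`, (J-cov′) glue-1 `emb_Γ (cover^*η) = pieceEmb_{M_{Γ.K}} ((embLift_{Γ₁} η) ∘ levelCover)`, (J-τ34)(c) theta-3 translation stability of admissible generating theta forms + CLASSMAP descent. 0 Prop defs, 0 records, nothing cited, MODEL-N ±0, E unchanged. EVIDENCE: farm/build-meeting2.log rc 0 / 0 warnings / 41 s; farm/ax_meeting.log 17/17 ⊆ trio; tokens 0; FQN clash grep 0) (`HOME/mc/pub-hodgecm-mc-binder-1-g8/stage/HodgeCM/Model/Binders/Real34Meeting.lean`, md5 4b84a052, 448 lines);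
landed by the gen-12 packager (p-g12) in gate run 36 as `HodgeCM/Model/Binders/Real34Meeting.lean` (verbatim).
-/
/-
Origin: speedrun cell pub-hodgecm, MODEL-CONSTRUCTION sub-cell, unit pub-hodgecm-mc-binder-1-g8 (BINDER PROVER, gen 8; node
B2-meet, BINDER-OWNERS row 15 `real34`, hypothesis (L-loc) of kit row #14 `Model/Binders/Real34Meet`), seat
prover-pub-hodgecm-mc-binder-1-g8-0, 2026-08-19.
Target in PKG: HodgeCM/Model/Binders/Real34Meeting.lean (NEW additive leaf; imports this lineage's kit row #2″
`Model/Binders/Gen12Junctions` (for `QuotientModel.realise/wedge₂/leftInvCont₂`), mc-discharge-1's `Model/Junction/LevelSaturation`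
(D-1′ #3), the installed junctions `Model/Junction/{PieceUnfolding, LevelChange}` and FOUR vendored twins of ACCEPTED tree files
`Literature/NumberTheory/Automorphic/LevelOrbit{Meeting, SplitGeneration, MeetingProjection, MeetingProjectionSplit}` (mc-autform-2's
meeting lemma); nothing landed imports it).  WORLD: RUN-35 + those rows; `Level V`-FREE (no `levelOf`/`Γ.K` token), hence unchanged
under the (W1) root packet.
KERNEL ONLY: 0 records, 0 `Prop` definitions, nothing cited, MODEL-N ±0, E unchanged; two data definitions (`QuotientModel.rTranslate`,
`QuotientModel.rTranslate₂`: right translates of global functions).  Expected `#print axioms`: {propext, Classical.choice, Quot.sound}.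
-/
import Summits.HodgeConjecture.HodgeCM.Model.Binders.Gen12Junctions_2
import Summits.HodgeConjecture.HodgeCM.Model.Junction.LevelSaturation
import Summits.HodgeConjecture.HodgeCM.Model.Junction.PieceUnfolding
import Summits.HodgeConjecture.HodgeCM.Model.Junction.LevelChange
import Literature.NumberTheory.Automorphic.LevelOrbitMeetingProjectionSplit

/-!
# Row `real34`: the MEETING step of (L-loc) — a non-trivial pairing with a piece-embedded class localises to a translated sub-piece

Kit row #14 `Model/Binders/Real34Meet` reduces the `meet` clause of `Real34FunBridge` to ONE cross-level hypothesis (L-loc):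
«a non-trivial pairing `⟪Λ_{Γ₁}(ω₁, ω₂), realise (G₃ ∧ G₄)⟫ ≠ 0` localises to some level `Γ ≤ Γ₁` as a non-trivial pairing of
`Λ_Γ(cover^*ω₁, cover^*ω₂)` with the realised wedge of saturated representatives of two (34) theta classes AT `Γ`».  By the
content ruling of model1 (STATUS 2026-08-19T16:27:22Z) (L-loc) is a JUNCTION-COMPOSITE (D1-meet) ⊕ (J-cov′) ⊕ (E3) ⊕ (J-τ34).
This file PROVES the automorphic part — (D1-meet) applied + (J-τ34)(a)(b) — in `Level`-free currency, so that it is untouched by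
the (W1) root packet and can be consumed verbatim by the RUN-37 assembly `Model/Binders/Real34Localisation` (this lineage):

* § 1 (`QuotientModel`): right translates `rTranslate φ a : g ↦ φ (g a)` of global left-invariant functions (scalar and `ℂ²`-valued),
  `wedge₂_rTranslate₂` (the global wedge commutes with right translation) and **`R_realise`**: `R(a) (realise φ) = realise (φ(· a))`
  — (J-τ34)(a): the translate of a realised global wedge is the realised wedge of the translated representatives.
* § 2 (adelic bookkeeping on `U(V)(𝔸) ≃ U(V)(L ⊗ ℝ) × U(V)(𝔸_f)`, `e₀ = cmAdelicProdEquiv`): for `k ∈ M_{K₁} = e₀⁻¹(G_∞ × K₁)` with finite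
  part `k_f ∈ K₁`, **`conjLevel_cmSplitLevel_inf_eq`**: `k⁻¹ M_{K₁ ∩ K'} k = M_{K₁ ∩ k_f⁻¹ K' k_f}`; and **`sat_rTranslate₂`** — (J-τ34)(b):
  a representative right-invariant under the saturation group `e(awayFromCM ⊓ M_{K'})` of the finite level `K'` has its `κ⁻¹`-translate
  (`κ = e k`) right-invariant under the saturation group of every `K'' ≤ k_f⁻¹ K' k_f` (`awayFromCM` is a kernel, hence normal).
* § 3 **`exists_inner_pieceEmb_rTranslate_ne_zero`** — THE MEETING STEP: if the class `pieceEmb_{M_{K₁}} f ∈ L²([G_U])` of a continuous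
  function `f` on the principal arithmetic quotient `Λ_{K₁} \ U(V)(L ⊗ ℝ)` (for (L-loc): `f` = emb's principal lift of the top form of
  `ω₁ ∪ ω₂`, `Λ_{Γ₁}(ω₁, ω₂) = pieceEmb f` by `EmbInstance.embOf_apply`) pairs non-trivially with the realised global wedge
  `realise (G₃ ∧ G₄)` of two representatives saturated at the finite level `K'`, then for some `k_f ∈ K₁` the class at the finite level
  `K₁ ∩ k_f⁻¹ K' k_f`, lifted through the SAME principal piece from the pull-back `f ∘ levelCover`, pairs non-trivially with the realised
  wedge of the translates `G₃(· κ⁻¹)`, `G₄(· κ⁻¹)`, `κ = e(e₀⁻¹(1, k_f))`, and these translates are saturated at `K₁ ∩ k_f⁻¹ K' k_f`.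
  Proof = the tree's meeting lemma `LevelOrbitMeeting.exists_mem_inner_translateLp_ne_zero` (Getz–Hahn (6.8)) for `M = M_{K₁}`,
  `M' = M_{K₁ ∩ K'}`, representatives from `LevelOrbitSplitGeneration.exists_finset_splitLevel_inf_eq_mul_of_isCompact` (`K₁` compact open,
  `K'` open), compactness of all arithmetic quotients from Godement (`Godement.compactSpace_adelicUnitaryQuot`, anisotropy `hV`) via
  `compactSpace_quotient_pieceLattice_conjLevel_inv`, re-levelling `pieceLiftLp_levelCover_congr`, and the unitary transport
  `QuotientModel.transportL2` (`inner_pieceEmb_left_eq_inner_pieceLiftLp`, `transportL2_translateLp`) + § 1.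

What remains of (L-loc) after this file (RUN 37, `Model/Binders/Real34Localisation`): (E3) the met level as the honest pair
`(Γ(K₁ ∩ k_f⁻¹ K' k_f), K₁ ∩ k_f⁻¹ K' k_f)` of the (W1) `Level` structure; (J-cov′) glue-1's emb-lane junction
`emb_Γ (cover^* η) = pieceEmb_{M_{Γ.K}} ((embLift_{Γ₁} η) ∘ levelCover)`; (J-τ34)(c) theta-3's translation stability of admissible
generating theta forms + CLASSMAP descent.  Nothing here is a claim of the manuscripts under adjudication.
-/

set_option autoImplicit false

noncomputable section

open scoped InnerProductSpace
open MeasureTheory MulAction Set Filter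
open Literature.MeasureTheory.Group
open Literature.NumberTheory.Automorphic Literature.NumberTheory.Automorphic.UnitaryGroup
open Literature.NumberTheory.Automorphic.LevelOrbit
open NumberField

namespace HodgeCM

/-! ## 1. Right translates of global functions and their realisations -/

namespace QuotientModel

open HodgeCM.PerL34 HodgeCM.PerL34.QuotientSmoothing

variable (Q : QuotientModel)

/-- The right translate `g ↦ φ (g a)` of a left-`Γ`-invariant continuous function (again left-invariant and continuous). -/
def rTranslate (φ : Q.leftInvCont) (a : Q.G) : Q.leftInvCont :=
  ⟨fun g => (φ : Q.G → ℂ) (g * a),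
    fun γ hγ g => by
      show (φ : Q.G → ℂ) (γ * g * a) = (φ : Q.G → ℂ) (g * a)
      rw [mul_assoc]
      exact φ.2.1 γ hγ (g * a),
    φ.2.2.comp (continuous_id.mul continuous_const)⟩

/-- (Ported verbatim from the HodgeCMPerL package; no docstring in the source.) -/
@[simp] theorem coe_rTranslate (φ : Q.leftInvCont) (a : Q.G) :
    ((Q.rTranslate φ a : Q.leftInvCont) : Q.G → ℂ) = fun g => (φ : Q.G → ℂ) (g * a) := rfl

/-- The right translate `g ↦ F (g a)` of a left-`Γ`-invariant `ℂ²`-valued function with continuous coordinates. -/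
def rTranslate₂ (F : Q.leftInvCont₂) (a : Q.G) : Q.leftInvCont₂ :=
  ⟨fun g => (F : Q.G → (Fin 2 → ℂ)) (g * a),
    fun γ hγ g => by
      show (F : Q.G → (Fin 2 → ℂ)) (γ * g * a) = (F : Q.G → (Fin 2 → ℂ)) (g * a)
      rw [mul_assoc]
      exact F.2.1 γ hγ (g * a),
    fun i => (F.2.2 i).comp (continuous_id.mul continuous_const)⟩

/-- (Ported verbatim from the HodgeCMPerL package; no docstring in the source.) -/
@[simp] theorem coe_rTranslate₂ (F : Q.leftInvCont₂) (a : Q.G) :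
    ((Q.rTranslate₂ F a : Q.leftInvCont₂) : Q.G → (Fin 2 → ℂ)) = fun g => (F : Q.G → (Fin 2 → ℂ)) (g * a) := rfl

/-- (Ported verbatim from the HodgeCMPerL package; no docstring in the source.) -/
theorem rTranslate₂_one (F : Q.leftInvCont₂) : Q.rTranslate₂ F 1 = F :=
  Subtype.ext (funext fun g => by
    show (F : Q.G → (Fin 2 → ℂ)) (g * 1) = (F : Q.G → (Fin 2 → ℂ)) g
    rw [mul_one])

/-- **The global wedge commutes with right translation.** -/
theorem wedge₂_rTranslate₂ (F F' : Q.leftInvCont₂) (a : Q.G) :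
    Q.wedge₂ (Q.rTranslate₂ F a) (Q.rTranslate₂ F' a) = Q.rTranslate (Q.wedge₂ F F') a :=
  Subtype.ext (funext fun _ => rfl)

/-- **(J-τ34)(a) — translating a realised global function**: `R(a) (realise φ) = realise (φ(· a))` in `L²(G ⧸ Γ, ν)`
(`R(a) v = v(a⁻¹ • ·)`, `realise φ (gΓ) = φ(g⁻¹)`, and `(a⁻¹ g)⁻¹ = g⁻¹ a`). -/
theorem R_realise (φ : Q.leftInvCont) (a : Q.G) : Q.R a (Q.realise φ) = Q.realise (Q.rTranslate φ a) := by
  apply Lp.ext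
  have h1 : ((Q.R a (Q.realise φ) : Q.H) : Q.G ⧸ Q.Γ → ℂ) =ᵐ[Q.ν]
      fun y => ((Q.realise φ : Q.H) : Q.G ⧸ Q.Γ → ℂ) (a⁻¹ • y) := by
    rw [R_eq, ρHom_apply]
    exact coeFn_ρ Q.ν a _
  have h2 : ((Q.realise φ : Q.H) : Q.G ⧸ Q.Γ → ℂ) =ᵐ[Q.ν] Q.descendInv φ := by
    rw [realise_apply]
    exact ContinuousMap.coeFn_toLp (E := ℂ) (p := 2) (μ := Q.ν) (𝕜 := ℂ) _
  have h3 : (fun y => ((Q.realise φ : Q.H) : Q.G ⧸ Q.Γ → ℂ) (a⁻¹ • y)) =ᵐ[Q.ν] fun y => Q.descendInv φ (a⁻¹ • y) :=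
    (measurePreserving_smul a⁻¹ Q.ν).quasiMeasurePreserving.ae_eq_comp h2
  have h4 : ((Q.realise (Q.rTranslate φ a) : Q.H) : Q.G ⧸ Q.Γ → ℂ) =ᵐ[Q.ν] Q.descendInv (Q.rTranslate φ a) := by
    rw [realise_apply]
    exact ContinuousMap.coeFn_toLp (E := ℂ) (p := 2) (μ := Q.ν) (𝕜 := ℂ) _
  refine h1.trans (h3.trans (EventuallyEq.trans (Eventually.of_forall fun y => ?_) h4.symm))
  induction y using QuotientGroup.induction_on with
  | H g =>
    show Q.descendInv φ (QuotientGroup.mk (a⁻¹ * g)) = Q.descendInv (Q.rTranslate φ a) (QuotientGroup.mk g)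
    rw [descendInv_mk, descendInv_mk, mul_inv_rev, inv_inv]
    rfl

/-- The same for the realised global wedge of two `ℂ²`-valued representatives. -/
theorem R_realise_wedge₂ (F F' : Q.leftInvCont₂) (a : Q.G) :
    Q.R a (Q.realise (Q.wedge₂ F F')) = Q.realise (Q.wedge₂ (Q.rTranslate₂ F a) (Q.rTranslate₂ F' a)) := by
  rw [R_realise, wedge₂_rTranslate₂]

end QuotientModel

/-! ## 2. Adelic bookkeeping: conjugating split levels and saturation groups by `k ∈ M_{K₁}` -/

namespace Model

variable {L : CMField} {ι₁ : L →+* ℂ} (V : HermSpace3 L ι₁) (hV : IsAnisotropic L V.Hm)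

/-- `Adelic.regimeEquiv` TYPED on the tree currency `↥(adelicUnitaryGroup L V.Hm) ≃ₜ* (quotU V).G` (the two `adelicUnitaryGroup`s agree by
`rfl`, `Junction/TreeTwins.adelicUnitaryGroup_eq`; the ascription makes instance search at the tree types and at `(quotU V).G` meet the
canonical instances — mc-discharge-1's `set e : … := Adelic.regimeEquiv …` device, as a reducible name). -/
abbrev regimeEquivT : ↥(Literature.NumberTheory.Automorphic.adelicUnitaryGroup (L : Type) V.Hm) ≃ₜ* (quotU V).G :=
  Adelic.regimeEquiv L V.Hm hV

/-- `e g` is rational iff `g` is (`HermSpace3.regimeEquiv_mem_latticeModel_Γ_iff`, tree-typed). -/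
theorem regimeEquivT_mem_Γ_iff :
    ∀ g : ↥(Literature.NumberTheory.Automorphic.adelicUnitaryGroup (L : Type) V.Hm),
      regimeEquivT V hV g ∈ (quotU V).Γ ↔ g ∈ adelicUnitaryRat (L : Type) V.Hm :=
  V.regimeEquiv_mem_latticeModel_Γ_iff printFact_unitaryCompact_holds hV

/-- **`k⁻¹ M_{K₁ ∩ K'} k = M_{K₁ ∩ k_f⁻¹ K' k_f}`** for `k ∈ U(V)(𝔸)` with finite part `k_f ∈ K₁` (the sub-level of the meeting lemma,
`conjLevel M' k⁻¹`, read as the split level of an explicit compact open). -/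
theorem conjLevel_cmSplitLevel_inf_eq
    (K₁ K' : Subgroup (finAdelic (↥(maximalRealSubfield L)) L (IsCMField.complexConj L) 3 V.Hm))
    (k : ↥(Literature.NumberTheory.Automorphic.adelicUnitaryGroup (L : Type) V.Hm))
    (hk : (cmAdelicProdEquiv (L : Type) 3 V.Hm k).2 ∈ K₁) :
    conjLevel (cmSplitLevel (L : Type) 3 V.Hm (K₁ ⊓ K')) k⁻¹ =
      cmSplitLevel (L : Type) 3 V.Hm (K₁ ⊓ conjLevel K' ((cmAdelicProdEquiv (L : Type) 3 V.Hm k).2)⁻¹) := by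
  ext m
  rw [mem_conjLevel_iff, inv_inv, mem_cmSplitLevel_iff, mem_cmSplitLevel_iff, Subgroup.mem_inf, Subgroup.mem_inf,
    mem_conjLevel_iff, inv_inv]
  simp only [map_mul, map_inv, Prod.snd_mul, Prod.snd_inv]
  constructor
  · rintro ⟨h1, h2⟩
    refine ⟨?_, h2⟩
    have h := K₁.mul_mem (K₁.mul_mem (K₁.inv_mem hk) h1) hk
    have e : ((cmAdelicProdEquiv (L : Type) 3 V.Hm k).2)⁻¹ *
        ((cmAdelicProdEquiv (L : Type) 3 V.Hm k).2 * (cmAdelicProdEquiv (L : Type) 3 V.Hm m).2 *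
          ((cmAdelicProdEquiv (L : Type) 3 V.Hm k).2)⁻¹) * (cmAdelicProdEquiv (L : Type) 3 V.Hm k).2 =
        (cmAdelicProdEquiv (L : Type) 3 V.Hm m).2 := by group
    rwa [e] at h
  · rintro ⟨h1, h2⟩
    exact ⟨K₁.mul_mem (K₁.mul_mem hk h1) (K₁.inv_mem hk), h2⟩

/-- `awayFromCM` is a normal subgroup of `U(V)(𝔸)` (it is the kernel of `g ↦ (g_∞)_{ι₁}`). -/
theorem normal_awayFromCM : (awayFromCM 3 (L : Type) ι₁ V.Hm).Normal := by
  dsimp only [awayFromCM, awayFrom]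
  exact MonoidHom.normal_ker _

/-- **Currency: saturation read on `U(V)(𝔸)`.**  Right-invariance of a representative `G` under the saturation group
`satLevelRegimeOf V hV K = e(awayFromCM ⊓ M_K)` of the regime model (the shape of mc-discharge-1's `SatLevel`, unfolded) gives
right-invariance of `G ∘ e` under `satLevelOf V K = awayFromCM ⊓ M_K ≤ U(V)(𝔸)` (`e = regimeEquiv`, a group isomorphism). -/
theorem sat_comp_regimeEquiv_of_sat
    (K : Subgroup (finAdelic (↥(maximalRealSubfield L)) L (IsCMField.complexConj L) 3 V.Hm)) (G : (quotU V).leftInvCont₂)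
    (hG : ∀ g m : (quotU V).G, m ∈ satLevelRegimeOf V hV K →
      (G : (quotU V).G → (Fin 2 → ℂ)) (g * m) = (G : (quotU V).G → (Fin 2 → ℂ)) g) :
    ∀ g₀ : ↥(Literature.NumberTheory.Automorphic.adelicUnitaryGroup (L : Type) V.Hm), ∀ m₀ ∈ satLevelOf V K,
      (G : (quotU V).G → (Fin 2 → ℂ)) (regimeEquivT V hV (g₀ * m₀)) =
        (G : (quotU V).G → (Fin 2 → ℂ)) (regimeEquivT V hV g₀) :=
  fun g₀ m₀ hm₀ =>
    (congrArg (G : (quotU V).G → (Fin 2 → ℂ)) (map_mul (regimeEquivT V hV) g₀ m₀)).trans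
      (hG _ _ (mem_satLevelRegimeOf_of_mem V hV K hm₀))

/-- **Currency, converse**: right-invariance of `G ∘ e` under `satLevelOf V K` gives right-invariance of `G` under
`satLevelRegimeOf V hV K` (the `SatLevel` shape). -/
theorem sat_of_sat_comp_regimeEquiv
    (K : Subgroup (finAdelic (↥(maximalRealSubfield L)) L (IsCMField.complexConj L) 3 V.Hm)) (G : (quotU V).leftInvCont₂)
    (hG : ∀ g₀ : ↥(Literature.NumberTheory.Automorphic.adelicUnitaryGroup (L : Type) V.Hm), ∀ m₀ ∈ satLevelOf V K,
      (G : (quotU V).G → (Fin 2 → ℂ)) (regimeEquivT V hV (g₀ * m₀)) =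
        (G : (quotU V).G → (Fin 2 → ℂ)) (regimeEquivT V hV g₀)) :
    ∀ g m : (quotU V).G, m ∈ satLevelRegimeOf V hV K →
      (G : (quotU V).G → (Fin 2 → ℂ)) (g * m) = (G : (quotU V).G → (Fin 2 → ℂ)) g := by
  intro g m hm
  have h1 := hG ((regimeEquivT V hV).symm g) ((regimeEquivT V hV).symm m)
    ((mem_satLevelRegimeOf_iff V hV K m).1 hm)
  rw [map_mul (regimeEquivT V hV), ContinuousMulEquiv.apply_symm_apply, ContinuousMulEquiv.apply_symm_apply] at h1
  exact h1

/-- The translate by `e a₀` read on `U(V)(𝔸)`: `(G(· e a₀)) (e x) = G (e (x a₀))`. -/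
theorem rTranslate₂_apply_regimeEquiv (G : (quotU V).leftInvCont₂)
    (a₀ x : ↥(Literature.NumberTheory.Automorphic.adelicUnitaryGroup (L : Type) V.Hm)) :
    ((quotU V).rTranslate₂ G (regimeEquivT V hV a₀) : (quotU V).G → (Fin 2 → ℂ)) (regimeEquivT V hV x) =
      (G : (quotU V).G → (Fin 2 → ℂ)) (regimeEquivT V hV (x * a₀)) :=
  (congrArg (G : (quotU V).G → (Fin 2 → ℂ)) (map_mul (regimeEquivT V hV) x a₀)).symm

/-- **(J-τ34)(b) — saturation of the translated representative** (read on `U(V)(𝔸)`).  If `G ∘ e` is right-invariant under the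
saturation group `awayFromCM ⊓ M_{K'}` of the finite level `K'`, then for every `a₀ ∈ U(V)(𝔸)` the translate `G(· e a₀)` composed with `e`
is right-invariant under the saturation group of every finite level `K'' ≤ a₀,f K' a₀,f⁻¹` (`awayFromCM` is normal; the finite parts
conjugate). -/
theorem sat_rTranslate₂
    (K' K'' : Subgroup (finAdelic (↥(maximalRealSubfield L)) L (IsCMField.complexConj L) 3 V.Hm))
    (a₀ : ↥(Literature.NumberTheory.Automorphic.adelicUnitaryGroup (L : Type) V.Hm))
    (hK'' : K'' ≤ conjLevel K' (cmAdelicProdEquiv (L : Type) 3 V.Hm a₀).2)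
    (G : (quotU V).leftInvCont₂)
    (hG : ∀ g₀ : ↥(Literature.NumberTheory.Automorphic.adelicUnitaryGroup (L : Type) V.Hm), ∀ m₀ ∈ satLevelOf V K',
      (G : (quotU V).G → (Fin 2 → ℂ)) (regimeEquivT V hV (g₀ * m₀)) =
        (G : (quotU V).G → (Fin 2 → ℂ)) (regimeEquivT V hV g₀)) :
    ∀ g₀ : ↥(Literature.NumberTheory.Automorphic.adelicUnitaryGroup (L : Type) V.Hm), ∀ m₀ ∈ satLevelOf V K'',
      ((quotU V).rTranslate₂ G (regimeEquivT V hV a₀) : (quotU V).G → (Fin 2 → ℂ))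
          (regimeEquivT V hV (g₀ * m₀)) =
        ((quotU V).rTranslate₂ G (regimeEquivT V hV a₀) : (quotU V).G → (Fin 2 → ℂ))
          (regimeEquivT V hV g₀) := by
  intro g₀ m₀ hm₀
  have hconj : a₀⁻¹ * m₀ * a₀ ∈ satLevelOf V K' := by
    rw [mem_satLevelOf_iff] at hm₀ ⊢
    refine ⟨(normal_awayFromCM V).conj_mem' _ hm₀.1 a₀, ?_⟩
    rw [mem_cmSplitLevel_iff]
    simp only [map_mul, map_inv, Prod.snd_mul, Prod.snd_inv]
    have h2 := hK'' ((mem_cmSplitLevel_iff (L : Type) 3 V.Hm K'' _).1 hm₀.2)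
    rw [mem_conjLevel_iff] at h2
    exact h2
  rw [rTranslate₂_apply_regimeEquiv, rTranslate₂_apply_regimeEquiv,
    show g₀ * m₀ * a₀ = g₀ * a₀ * (a₀⁻¹ * m₀ * a₀) by group]
  exact hG (g₀ * a₀) _ hconj

include hV in
/-- **Compactness of the principal arithmetic quotient `Λ_K \ U(V)(L ⊗ ℝ)`** for an open finite level `K` (Godement, via
anisotropy `hV`) — the instance `pieceEmb_{M_K}` asks for, as a term for `haveI`. -/
theorem compactSpace_principalQuot
    (K : Subgroup (finAdelic (↥(maximalRealSubfield L)) L (IsCMField.complexConj L) 3 V.Hm))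
    (hK : IsOpen (K : Set (finAdelic (↥(maximalRealSubfield L)) L (IsCMField.complexConj L) 3 V.Hm))) :
    CompactSpace (arch (↥(maximalRealSubfield L)) L (IsCMField.complexConj L) 3 V.Hm ⧸
      pieceLattice (cmSplitLevel (L : Type) 3 V.Hm K) (adelicUnitaryRat (L : Type) V.Hm) (cmSplitProj (L : Type) 3 V.Hm K)
        (cmPrincipalPoint (L : Type) 3 V.Hm)) :=
  compactSpace_arch_quotient_cmPrincipalLattice_of_anisotropic (L : Type) 3 V.Hm K (hanis_of_isAnisotropic hV) hK

include hV in
/-- **Compactness of the principal arithmetic quotient at a sub-level `K ≤ K₁`, projection `π_{K₁}|_{M_K}`** (the spelling of the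
meeting lemma's sub-levels) — the instance family `exists_inner_pieceEmb_rTranslate₂_ne_zero` asks for, as a term for `haveI`. -/
theorem compactSpace_subQuot
    (K₁ K : Subgroup (finAdelic (↥(maximalRealSubfield L)) L (IsCMField.complexConj L) 3 V.Hm)) (h : K ≤ K₁)
    (hK : IsOpen (K : Set (finAdelic (↥(maximalRealSubfield L)) L (IsCMField.complexConj L) 3 V.Hm))) :
    CompactSpace (arch (↥(maximalRealSubfield L)) L (IsCMField.complexConj L) 3 V.Hm ⧸
      pieceLattice (cmSplitLevel (L : Type) 3 V.Hm K) (adelicUnitaryRat (L : Type) V.Hm)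
        ((cmSplitProj (L : Type) 3 V.Hm K₁).comp (Subgroup.inclusion (splitLevel_mono (cmAdelicProdEquiv (L : Type) 3 V.Hm).toMulEquiv h)))
        (cmPrincipalPoint (L : Type) 3 V.Hm)) := by
  haveI : CompactSpace (↥(Literature.NumberTheory.Automorphic.adelicUnitaryGroup (L : Type) V.Hm) ⧸ adelicUnitaryRat (L : Type) V.Hm) :=
    Godement.compactSpace_adelicUnitaryQuot (L : Type) V.Hm (hanis_of_isAnisotropic hV)
  exact compactSpace_quotient_pieceLattice _ (adelicUnitaryRat (L : Type) V.Hm) _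
    (isOpen_cmSplitLevel (L : Type) 3 V.Hm K hK)
    ((continuous_cmSplitProj (L : Type) 3 V.Hm K₁).comp (continuous_inclusion (splitLevel_mono (cmAdelicProdEquiv (L : Type) 3 V.Hm).toMulEquiv h)))
    (surjective_splitProj_comp_inclusion (cmAdelicProdEquiv (L : Type) 3 V.Hm).toMulEquiv h) (cmPrincipalPoint (L : Type) 3 V.Hm)

/-! ## 3. The meeting step -/


-- port_pkg: scope closed for this part
end Model
end HodgeCM
end
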